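import Literature.Analysis.SpecialFunctions.BesselKLaplaceMeasure
import HarnessLib

/-!
# Endpoint domination between two Bessel–Laplace kernel measures

Topic `Literature/Analysis/SpecialFunctions`, continuing `BesselKLaplaceMeasure`
(`coshMeasure ν c`, `gammaMeasure p t₀`, `besselLaplaceMeasure ν p c t₀ = (e^{-lt₀} coshMeasure ν c) ∗
gammaMeasure p t₀`). Near the left endpoint `c` of their common support, the kernel measure with
the LARGER power `p` is negligible against the one with the smaller power: for `0 < p₁ < p₂` and
every `κ > 0` there is `ε > 0` with
`besselLaplaceMeasure ν₂ p₂ c t₀ A ≤ κ · besselLaplaceMeasure ν₁ p₁ c t₀ A` for measurable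
`A ⊆ (c, c + ε)` (the densities behave like `(l - c)^{pᵢ - 1/2}` there). This is what makes the
SIGNED kernel of the Lennard-Jones force (`r⁻⁸ − r⁻¹⁴`, powers `p = 2` and `5` after the layer
transform) non-degenerate at the bottom of each Fourier shell. Everything here is PROVED.

* `setLIntegral_le_mul_of_forall_le` — set-wise domination `μ ≤ K ν` on measurable subsets of
  `S` gives `∫⁻_S f dμ ≤ K ∫⁻_S f dν`;
* `besselLaplaceMeasure_apply` — the section formula
  `besselLaplaceMeasure ν p c t₀ A = ∫ γ({y | x + y ∈ A}) d(e^{-lt₀} coshMeasure ν c)(x)`;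
* `coshMeasure_le_mul_coshMeasure` — `coshMeasure ν₂ c ≤ K · coshMeasure ν₁ c` on `(-∞, c cosh U]`
  (density ratio `e^{ν₂u}/e^{ν₁u}` bounded for `|u| ≤ U`);
* `gammaMeasure_le_mul_gammaMeasure` — `gammaMeasure p₂ t₀ ≤ κ · gammaMeasure p₁ t₀` on
  `(-∞, ε)` for small `ε` (density ratio `Γ(p₁) l^{p₂ - p₁}/Γ(p₂) → 0`);
* **`besselLaplaceMeasure_le_mul_near_endpoint`** — the domination of the convolutions on
  `(c, c + ε)` (only `x ∈ [c, c + ε)`, `y ∈ [0, ε)` contribute to `x + y ∈ (c, c + ε)`).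

[cite: Feller1971, XIII.2] (Laplace transforms of convolutions; the comparison itself is folklore.)
-/

noncomputable section

namespace Literature.Analysis.SpecialFunctions

open _root_.MeasureTheory Set Filter
open scoped ENNReal

/-! ## Two measure-theoretic helpers -/

/-- **Set-wise domination integrates.** If `μ A ≤ K · ν A` for every measurable `A ⊆ S`
(`S` measurable), then `∫⁻_S f dμ ≤ K · ∫⁻_S f dν` for every `f : ℝ → ℝ≥0∞`: the hypothesis says
`μ|_S ≤ K • ν|_S` as measures (`Measure.le_iff`), and the lower Lebesgue integral is monotone in
the measure (`lintegral_mono'`, `lintegral_smul_measure`). [folklore] -/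
theorem setLIntegral_le_mul_of_forall_le {μ ν : Measure ℝ} {S : Set ℝ} (hS : MeasurableSet S)
    {K : ℝ≥0∞} (h : ∀ A : Set ℝ, MeasurableSet A → A ⊆ S → μ A ≤ K * ν A) (f : ℝ → ℝ≥0∞) :
    ∫⁻ x in S, f x ∂μ ≤ K * ∫⁻ x in S, f x ∂ν := by
  have hle : μ.restrict S ≤ K • ν.restrict S := by
    rw [Measure.le_iff]
    intro s hs
    rw [Measure.restrict_apply hs, Measure.smul_apply, Measure.restrict_apply hs, smul_eq_mul]
    exact h _ (hs.inter hS) inter_subset_right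
  calc ∫⁻ x in S, f x ∂μ ≤ ∫⁻ x, f x ∂(K • ν.restrict S) := lintegral_mono' hle le_rfl
    _ = K * ∫⁻ x in S, f x ∂ν := by rw [lintegral_smul_measure, smul_eq_mul]

/-- **Section formula for `besselLaplaceMeasure`.** For measurable `A`,
`besselLaplaceMeasure ν p c t₀ A = ∫⁻ x, gammaMeasure p t₀ {y | x + y ∈ A} d(e^{-lt₀} coshMeasure ν c)(x)`
(`μ ∗ γ = (μ ⊗ γ).map (+)`, `Measure.map_apply`, `Measure.prod_apply`). [folklore] -/
theorem besselLaplaceMeasure_apply (ν p c t₀ : ℝ) {A : Set ℝ} (hA : MeasurableSet A) :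
    besselLaplaceMeasure ν p c t₀ A =
      ∫⁻ x, gammaMeasure p t₀ {y | x + y ∈ A}
        ∂((coshMeasure ν c).withDensity fun l => ENNReal.ofReal (Real.exp (-(l * t₀)))) := by
  unfold besselLaplaceMeasure
  rw [Measure.conv, Measure.map_apply measurable_add hA, Measure.prod_apply (measurable_add hA)]
  rfl

/-! ## The two factors separately -/

/-- **Comparison of two `coshMeasure`s near the endpoint.** For `c > 0`, `U ≥ 0` and real `ν₁, ν₂`
there is `K > 0` with `coshMeasure ν₂ c A ≤ K · coshMeasure ν₁ c A` for every measurable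
`A ⊆ (-∞, c cosh U]` (on the preimage `|u| ≤ U` the density ratio `e^{ν₂u}/e^{ν₁u}` is at most
`e^{|ν₂ - ν₁| U}`). [folklore] -/
theorem coshMeasure_le_mul_coshMeasure (ν₁ ν₂ : ℝ) {c : ℝ} (hc : 0 < c) {U : ℝ} (hU : 0 ≤ U) :
    ∃ K : ℝ, 0 < K ∧ ∀ A : Set ℝ, MeasurableSet A → A ⊆ Iic (c * Real.cosh U) →
      coshMeasure ν₂ c A ≤ ENNReal.ofReal K * coshMeasure ν₁ c A := by
  refine ⟨Real.exp (|ν₂ - ν₁| * U), Real.exp_pos _, fun A hA hAU => ?_⟩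
  unfold coshMeasure
  have hS : MeasurableSet ((fun u : ℝ => c * Real.cosh u) ⁻¹' A) := measurable_const_mul_cosh c hA
  rw [Measure.map_apply (measurable_const_mul_cosh c) hA,
    Measure.map_apply (measurable_const_mul_cosh c) hA, withDensity_apply _ hS,
    withDensity_apply _ hS, ← lintegral_const_mul _ (measurable_ofReal_exp_mul ν₁)]
  refine setLIntegral_mono ((measurable_ofReal_exp_mul ν₁).const_mul _) fun u hu => ?_
  have hu' : c * Real.cosh u ≤ c * Real.cosh U := hAU hu
  have habs : |u| ≤ U := by
    have h1 : Real.cosh u ≤ Real.cosh U := le_of_mul_le_mul_left hu' hc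
    rw [Real.cosh_le_cosh, abs_of_nonneg hU] at h1
    exact h1
  rw [← ENNReal.ofReal_mul (Real.exp_pos _).le, ← Real.exp_add]
  refine ENNReal.ofReal_le_ofReal (Real.exp_le_exp.2 ?_)
  have h2 : (ν₂ - ν₁) * u ≤ |ν₂ - ν₁| * U :=
    calc (ν₂ - ν₁) * u ≤ |(ν₂ - ν₁) * u| := le_abs_self _
      _ = |ν₂ - ν₁| * |u| := abs_mul _ _
      _ ≤ |ν₂ - ν₁| * U := mul_le_mul_of_nonneg_left habs (abs_nonneg _)
  linarith

/-- **Comparison of two `gammaMeasure`s near `0`.** For `0 < p₁ < p₂`, `t₀ > 0` and `κ > 0` there is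
`ε > 0` with `gammaMeasure p₂ t₀ A ≤ κ · gammaMeasure p₁ t₀ A` for measurable `A ⊆ (-∞, ε)`
(density ratio `Γ(p₁) l^{p₂ - p₁} / Γ(p₂) ≤ κ` for `l < ε := (κ Γ(p₂)/Γ(p₁))^{1/(p₂ - p₁)}`; `t₀ > 0`
is not needed and kept for a uniform API). [folklore] -/
theorem gammaMeasure_le_mul_gammaMeasure {p₁ p₂ t₀ : ℝ} (hp₁ : 0 < p₁) (hp : p₁ < p₂)
    (_ht₀ : 0 < t₀) {κ : ℝ} (hκ : 0 < κ) :
    ∃ ε : ℝ, 0 < ε ∧ ∀ A : Set ℝ, MeasurableSet A → A ⊆ Iio ε →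
      gammaMeasure p₂ t₀ A ≤ ENNReal.ofReal κ * gammaMeasure p₁ t₀ A := by
  have hp₂ : 0 < p₂ := hp₁.trans hp
  have hd : 0 < p₂ - p₁ := sub_pos.2 hp
  have hΓ₁ : 0 < Real.Gamma p₁ := Real.Gamma_pos_of_pos hp₁
  have hΓ₂ : 0 < Real.Gamma p₂ := Real.Gamma_pos_of_pos hp₂
  obtain ⟨R, hR⟩ : ∃ R : ℝ, R = κ * Real.Gamma p₂ / Real.Gamma p₁ := ⟨_, rfl⟩
  have hR0 : 0 < R := by rw [hR]; exact div_pos (mul_pos hκ hΓ₂) hΓ₁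
  refine ⟨R ^ (1 / (p₂ - p₁)), Real.rpow_pos_of_pos hR0 _, fun A hA hAε => ?_⟩
  unfold gammaMeasure
  rw [withDensity_apply _ hA, withDensity_apply _ hA, Measure.restrict_restrict hA,
    ← lintegral_const_mul _ (measurable_ofReal_gammaDensity p₁ t₀)]
  refine setLIntegral_mono ((measurable_ofReal_gammaDensity p₁ t₀).const_mul _) fun l hl => ?_
  have hl0 : 0 < l := hl.2
  have hlε : l < R ^ (1 / (p₂ - p₁)) := hAε hl.1
  -- `l ^ (p₂ - p₁) ≤ R`
  have hlR : l ^ (p₂ - p₁) ≤ R := by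
    have h1 : l ^ (p₂ - p₁) < (R ^ (1 / (p₂ - p₁))) ^ (p₂ - p₁) :=
      Real.rpow_lt_rpow hl0.le hlε hd
    rw [← Real.rpow_mul hR0.le, one_div_mul_cancel hd.ne', Real.rpow_one] at h1
    exact h1.le
  rw [← ENNReal.ofReal_mul hκ.le]
  refine ENNReal.ofReal_le_ofReal ?_
  rw [show p₂ - 1 = (p₂ - p₁) + (p₁ - 1) by ring, Real.rpow_add hl0]
  have hE : 0 < Real.exp (-(l * t₀)) := Real.exp_pos _
  have hb : 0 < l ^ (p₁ - 1) := Real.rpow_pos_of_pos hl0 _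
  have key : l ^ (p₂ - p₁) * l ^ (p₁ - 1) / Real.Gamma p₂ ≤ κ * (l ^ (p₁ - 1) / Real.Gamma p₁) := by
    rw [div_le_iff₀ hΓ₂]
    calc l ^ (p₂ - p₁) * l ^ (p₁ - 1) ≤ R * l ^ (p₁ - 1) := mul_le_mul_of_nonneg_right hlR hb.le
      _ = κ * (l ^ (p₁ - 1) / Real.Gamma p₁) * Real.Gamma p₂ := by
        rw [hR]
        field_simp
  calc Real.exp (-(l * t₀)) * (l ^ (p₂ - p₁) * l ^ (p₁ - 1) / Real.Gamma p₂)
      ≤ Real.exp (-(l * t₀)) * (κ * (l ^ (p₁ - 1) / Real.Gamma p₁)) :=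
        mul_le_mul_of_nonneg_left key hE.le
    _ = κ * (Real.exp (-(l * t₀)) * (l ^ (p₁ - 1) / Real.Gamma p₁)) := by ring

/-! ## The convolution near the endpoint -/

/-- **Endpoint domination.** For `0 < p₁ < p₂`, `c, t₀ > 0`, real `ν₁, ν₂` and `κ > 0` there is
`ε > 0` such that `besselLaplaceMeasure ν₂ p₂ c t₀ A ≤ κ · besselLaplaceMeasure ν₁ p₁ c t₀ A` for
every measurable `A ⊆ (c, c + ε)`. Proof: by the section formula both sides are
`∫ γᵢ({y | x + y ∈ A}) dμᵢ(x)` with `μᵢ = e^{-lt₀} coshMeasure νᵢ c` carried by `[c, ∞)` and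
`γᵢ = gammaMeasure pᵢ t₀` carried by `[0, ∞)`; for `x ≥ c` the section lies in `(-∞, ε)`, where
`γ₂ ≤ (κ/K) γ₁` (`gammaMeasure_le_mul_gammaMeasure`), and the resulting integrand vanishes for
`x ≥ c + ε`, so the outer integral only sees `(-∞, c + ε) ⊆ (-∞, c cosh 1]`, where `μ₂ ≤ K μ₁`
(`coshMeasure_le_mul_coshMeasure`, the density `e^{-lt₀}` being common to both). [folklore] -/
theorem besselLaplaceMeasure_le_mul_near_endpoint (ν₁ ν₂ : ℝ) {p₁ p₂ c t₀ : ℝ} (hp₁ : 0 < p₁)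
    (hp : p₁ < p₂) (hc : 0 < c) (ht₀ : 0 < t₀) {κ : ℝ} (hκ : 0 < κ) :
    ∃ ε : ℝ, 0 < ε ∧ ∀ A : Set ℝ, MeasurableSet A → A ⊆ Ioo c (c + ε) →
      besselLaplaceMeasure ν₂ p₂ c t₀ A ≤
        ENNReal.ofReal κ * besselLaplaceMeasure ν₁ p₁ c t₀ A := by
  -- Step 1: domination of the cosh factors on `(-∞, c cosh 1]`
  obtain ⟨K, hK, hKle⟩ := coshMeasure_le_mul_coshMeasure ν₁ ν₂ hc zero_le_one
  -- Step 2: domination of the Gamma factors on `(-∞, εγ)` with constant `κ / K`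
  obtain ⟨εγ, hεγ, hγle⟩ :=
    gammaMeasure_le_mul_gammaMeasure (t₀ := t₀) hp₁ hp ht₀ (div_pos hκ hK)
  have hcosh : 0 < c * (Real.cosh 1 - 1) :=
    mul_pos hc (sub_pos.2 (Real.one_lt_cosh.2 one_ne_zero))
  have hε₁ : min εγ (c * (Real.cosh 1 - 1)) ≤ εγ := min_le_left _ _
  have hε₂ : c + min εγ (c * (Real.cosh 1 - 1)) ≤ c * Real.cosh 1 := by
    have := min_le_right εγ (c * (Real.cosh 1 - 1))
    linarith
  refine ⟨min εγ (c * (Real.cosh 1 - 1)), lt_min hεγ hcosh, fun A hA hAsub => ?_⟩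
  rw [besselLaplaceMeasure_apply ν₂ p₂ c t₀ hA, besselLaplaceMeasure_apply ν₁ p₁ c t₀ hA]
  set ε : ℝ := min εγ (c * (Real.cosh 1 - 1)) with hε
  set μ₁ : Measure ℝ :=
    (coshMeasure ν₁ c).withDensity fun l => ENNReal.ofReal (Real.exp (-(l * t₀))) with hμ₁
  set μ₂ : Measure ℝ :=
    (coshMeasure ν₂ c).withDensity fun l => ENNReal.ofReal (Real.exp (-(l * t₀))) with hμ₂
  -- domination `μ₂ ≤ K μ₁` on measurable subsets of `(-∞, c cosh 1]`: the density is common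
  have hμle : ∀ B : Set ℝ, MeasurableSet B → B ⊆ Iic (c * Real.cosh 1) →
      μ₂ B ≤ ENNReal.ofReal K * μ₁ B := by
    intro B hB hBsub
    rw [hμ₂, hμ₁, withDensity_apply _ hB, withDensity_apply _ hB]
    exact setLIntegral_le_mul_of_forall_le hB
      (fun A' hA' hA'B => hKle A' hA' (hA'B.trans hBsub)) _
  -- the sections `{y | x + y ∈ A}`
  have hTm : ∀ x : ℝ, MeasurableSet {y : ℝ | x + y ∈ A} := fun x => measurable_const_add x hA
  have hT₁ : ∀ x : ℝ, c ≤ x → {y : ℝ | x + y ∈ A} ⊆ Iio εγ := by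
    intro x hx y hy
    have hy' : x + y ∈ A := hy
    have h2 := (hAsub hy').2
    rw [mem_Iio]
    linarith
  have hT₂ : ∀ x : ℝ, c + ε ≤ x → {y : ℝ | x + y ∈ A} ⊆ Iio 0 := by
    intro x hx y hy
    have hy' : x + y ∈ A := hy
    have h2 := (hAsub hy').2
    rw [mem_Iio]
    linarith
  -- `μ₂` is carried by `[c, ∞)`
  have hae : ∀ᵐ x ∂μ₂, c ≤ x := by
    have h0 : μ₂ (Iio c) = 0 := withDensity_coshMeasure_Iio ν₂ t₀ hc
    filter_upwards [measure_eq_zero_iff_ae_notMem.1 h0] with x hx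
    exact not_lt.1 hx
  -- the integrand `x ↦ γ₁ {y | x + y ∈ A}` vanishes off `(-∞, c + ε)`
  have hG : ∀ x : ℝ, gammaMeasure p₁ t₀ {y : ℝ | x + y ∈ A} =
      (Iio (c + ε)).indicator (fun x => gammaMeasure p₁ t₀ {y : ℝ | x + y ∈ A}) x := by
    intro x
    by_cases hx : x ∈ Iio (c + ε)
    · rw [indicator_of_mem hx]
    · rw [indicator_of_notMem hx]
      exact measure_mono_null (hT₂ x (not_lt.1 hx)) (gammaMeasure_Iio p₁ t₀)
  -- the outer domination
  have hstep : ∫⁻ x, gammaMeasure p₁ t₀ {y : ℝ | x + y ∈ A} ∂μ₂ ≤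
      ENNReal.ofReal K * ∫⁻ x, gammaMeasure p₁ t₀ {y : ℝ | x + y ∈ A} ∂μ₁ :=
    calc ∫⁻ x, gammaMeasure p₁ t₀ {y : ℝ | x + y ∈ A} ∂μ₂
        = ∫⁻ x in Iio (c + ε), gammaMeasure p₁ t₀ {y : ℝ | x + y ∈ A} ∂μ₂ := by
          rw [lintegral_congr hG, lintegral_indicator measurableSet_Iio]
      _ ≤ ENNReal.ofReal K * ∫⁻ x in Iio (c + ε), gammaMeasure p₁ t₀ {y : ℝ | x + y ∈ A} ∂μ₁ :=
          setLIntegral_le_mul_of_forall_le measurableSet_Iio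
            (fun B hB hBsub => hμle B hB
              (hBsub.trans fun x hx => le_of_lt (lt_of_lt_of_le hx hε₂))) _
      _ ≤ ENNReal.ofReal K * ∫⁻ x, gammaMeasure p₁ t₀ {y : ℝ | x + y ∈ A} ∂μ₁ :=
          mul_le_mul_right (setLIntegral_le_lintegral _ _) _
  -- assemble
  calc ∫⁻ x, gammaMeasure p₂ t₀ {y : ℝ | x + y ∈ A} ∂μ₂
      ≤ ∫⁻ x, ENNReal.ofReal (κ / K) * gammaMeasure p₁ t₀ {y : ℝ | x + y ∈ A} ∂μ₂ := by
        refine lintegral_mono_ae ?_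
        filter_upwards [hae] with x hx
        exact hγle _ (hTm x) (hT₁ x hx)
    _ = ENNReal.ofReal (κ / K) * ∫⁻ x, gammaMeasure p₁ t₀ {y : ℝ | x + y ∈ A} ∂μ₂ :=
        lintegral_const_mul' _ _ ENNReal.ofReal_ne_top
    _ ≤ ENNReal.ofReal (κ / K) *
          (ENNReal.ofReal K * ∫⁻ x, gammaMeasure p₁ t₀ {y : ℝ | x + y ∈ A} ∂μ₁) :=
        mul_le_mul_right hstep _
    _ = ENNReal.ofReal κ * ∫⁻ x, gammaMeasure p₁ t₀ {y : ℝ | x + y ∈ A} ∂μ₁ := by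
        rw [← mul_assoc, ← ENNReal.ofReal_mul (div_pos hκ hK).le, div_mul_cancel₀ κ hK.ne']

end Literature.Analysis.SpecialFunctions
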